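import Summits.BirchSwinnertonDyer.BirchSwinnertonDyer.Theorems.BiquadraticEisensteinDescentHeegnerTwistCouplingInSupplyHeavySparseSylvester
import Summits.BirchSwinnertonDyer.BirchSwinnertonDyer.Theorems.BiquadraticEisensteinDescentHeegnerTwistCouplingInSupplyHeavySparseRelative
import Literature.NumberTheory.EllipticCurves.DeuringHeckeContinuationHolds
import HarnessLib

set_option linter.dupNamespace false -- `Summit.BirchSwinnertonDyer.BirchSwinnertonDyer.Theorems.…` (summit = sub, D-0017)
set_option autoImplicit false

/-!
# Crux `HeegnerTwistCouplingInSupply` (stmt-BirchSwinnertonDyer-21381), card `heavy-discriminant-sparsity` —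
# §F the Sylvester corner from a positive PROPORTION of `3`-descent certificates in the Heegner family of `W_p`
# (relative form of §D; modulo `hDesc` and Burungale–Tian only)

Route `BiquadraticEisensteinDescent` (cell `pub/bsd-wall`; width seat `bsd-wall-cm-bed-w4` g29; THEOREMS ONLY,
`--supports 21381`). Sixth file of the unit «HEAVY-DISCRIMINANT SPARSITY + DENSITY DOOR». §D
(`cruxOnSylvesterCorner_of_certificateDensity`) asks for `δ·A·p²` certified `d ∈ [−A·p², −1]` (absolute count); the natural
Davenport–Heilbronn statement is RELATIVE: a proportion `δ` of the Heegner family of `W_p : y² + p·y = x³` in the window carries a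
certificate. Since every prime of `N(W_p)` is `3` or `p` (`SylvesterCorner.eq_three_or_eq_of_prime_dvd_conductorNorm_W`), the family
`A_{N(W_p)}(A·p²)` contains `A_{3p²}(A·p²)`, which has `≥ A·p²/360` members for `A ≥ 600²` uniformly in `p` (§E,
`card_ambient_window_ge` with `N₀ = 3`), so the relative hypothesis implies the absolute one with `δ/360`.

* `satisfiesHeegnerHypothesis_of_prime_support`, `ambient_subset_of_prime_support` — the Heegner family only depends on the prime
  support of the level (antitone in it);
* ★ `card_ambient_sylvester_ge` — for a prime `p ≡ 8 (mod 9)` and `A ≥ 600²`: `#A_{N(W_p)}(A·p²) ≥ A·p²/360`;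
* ★★ `cruxOnSylvesterCorner_of_relativeCertificateDensity` — MODULO `hDesc` (3-descent, card `splitting-bias` L1) and
  Burungale–Tian `hBT` (Deuring–Hecke is the tree theorem `DeuringHecke.hasEntireLFunction_of_j_mem_maximalCMJInvariants_holds`):
  if for some `A ≥ 600²`, `δ > 0`, `p₁`, for every prime `p ≡ 8 (mod 9)`, `p ≥ p₁`, at least the proportion `δ` of the Heegner
  family `A_{N(W_p)}(A·p²)` is certified (`(d/3) = (d/p) = 1`, `3 ∤ h(d)`, Lucas non-cube), then for some `p₂` the conclusion of
  crux 21381 holds at `(W_p, p)` for every prime `p ≡ 8 (mod 9)`, `p ≥ p₂`.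

HONEST FRAMING: a door; the proportion hypothesis is OPEN (card §INSTANCE: Davenport–Heilbronn counts with one local condition at
`p`, floor `1/6 − O(A^{−1/2})`, census j335370 ≈ 0.39–0.45 certified); `p₂` ineffective; `hDesc` not in the tree; C⁺, crux 21381
and BSD are NOT proved by any of this. [cite: CohenPazuki2009, §2] [cite: BurungaleTian2026, Thm. 1.1] [cite: GrossLMS1991, §1]
-/

noncomputable section

open scoped Classical
open Finset
open WeierstrassCurve
open Literature.NumberTheory.EllipticCurves
open Summit.BirchSwinnertonDyer.BirchSwinnertonDyer.Theorems.SylvesterCorner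
open Summit.BirchSwinnertonDyer.BirchSwinnertonDyer.Theorems.DisjointDivisibility

namespace Summit.BirchSwinnertonDyer.BirchSwinnertonDyer.Theorems.HeavyDiscriminant

/-! ## §F.1 The Heegner family depends only on the prime support of the level -/

/-- **Heegner for `N` from Heegner for `M` when every prime of `N` divides `M`** (the hypothesis is prime-wise).
[cite: GrossLMS1991, §1] -/
theorem satisfiesHeegnerHypothesis_of_prime_support {M N : ℕ} {K : Type} [Field K]
    (hMN : ∀ r : ℕ, r.Prime → r ∣ N → r ∣ M) (h : SatisfiesHeegnerHypothesis M K) :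
    SatisfiesHeegnerHypothesis N K :=
  fun r hr hrN ↦ h r hr (hMN r hr hrN)

/-- **The Heegner family is antitone in the prime support of the level**: if every prime of `N` divides `M` then
`A_M(Y) ⊆ A_N(Y)`. [folklore] -/
theorem ambient_subset_of_prime_support {M N : ℕ} (hMN : ∀ r : ℕ, r.Prime → r ∣ N → r ∣ M) (Y : ℕ) :
    ambient M Y ⊆ ambient N Y := by
  intro d hd
  rw [ambient, mem_filter] at hd ⊢
  obtain ⟨hdI, K, iF, iN, hK, hdisc, h4, hH⟩ := hd
  exact ⟨hdI, K, iF, iN, hK, hdisc, h4, satisfiesHeegnerHypothesis_of_prime_support hMN hH⟩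

/-- ★ **The Heegner family of the Sylvester curve is large in the window, uniformly in `p`**: for a prime `p ≡ 8 (mod 9)` and
`A ≥ 600²`, `#A_{N(W_p)}(A·p²) ≥ A·p²/360` (every prime of `N(W_p)` is `3` or `p`, so `A_{3p²}(A·p²) ⊆ A_{N(W_p)}(A·p²)`, and §E's
`card_ambient_window_ge` with `N₀ = 3`). [folklore] -/
theorem card_ambient_sylvester_ge {p A : ℕ} (hp : p.Prime) (hp9 : p % 9 = 8) (hA : 600 ^ 2 ≤ A)
    [(⟨0, 0, (p : ℚ), 0, 0⟩ : WeierstrassCurve ℚ).IsElliptic] :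
    ((A * p ^ 2 : ℕ) : ℝ) / 360 ≤
      ((ambient ((⟨0, 0, (p : ℚ), 0, 0⟩ : WeierstrassCurve ℚ).conductorNorm ℤ) (A * p ^ 2)).card : ℝ) := by
  have hp2 : p ≠ 2 := by rintro rfl; omega
  have hp3 : ¬ p ∣ 3 := by
    intro h
    have := (Nat.prime_dvd_prime_iff_eq hp Nat.prime_three).mp h
    omega
  have hsub : ambient (3 * p ^ 2) (A * p ^ 2) ⊆
      ambient ((⟨0, 0, (p : ℚ), 0, 0⟩ : WeierstrassCurve ℚ).conductorNorm ℤ) (A * p ^ 2) := by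
    refine ambient_subset_of_prime_support (fun r hr hrN ↦ ?_) _
    rcases eq_three_or_eq_of_prime_dvd_conductorNorm_W hp hr hrN with rfl | rfl
    · exact Dvd.intro (p ^ 2) rfl
    · exact Dvd.intro_left (3 * r) (by ring)
  have h3 := card_ambient_window_ge (N₀ := 3) (p := p) (A := A) (by norm_num) hp hp2 hp3 (by norm_num; omega)
  have hcard : ((ambient (3 * p ^ 2) (A * p ^ 2)).card : ℝ) ≤
      ((ambient ((⟨0, 0, (p : ℚ), 0, 0⟩ : WeierstrassCurve ℚ).conductorNorm ℤ) (A * p ^ 2)).card : ℝ) := by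
    exact_mod_cast card_le_card hsub
  have h360 : ((A * p ^ 2 : ℕ) : ℝ) / 360 = ((A * p ^ 2 : ℕ) : ℝ) / (120 * (3 : ℕ)) := by norm_num
  rw [h360]
  exact h3.trans hcard

/-! ## §F.2 ★★ The Sylvester corner from a proportion of certificates -/

/-- ★★ **The Sylvester corner in the bulk from a positive PROPORTION of `3`-descent certificates in the Heegner family of `W_p`.**
MODULO `hDesc` (the `3`-isogeny descent, card `splitting-bias` L1 in Lucas form) and Burungale–Tian `hBT`: if for some `A ≥ 600²`,
`δ > 0` and `p₁`, every prime `p ≡ 8 (mod 9)`, `p ≥ p₁`, has at least `δ·#A_{N(W_p)}(A·p²)` certified `d ∈ [−A·p², −1]`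
(`d = d_K`, `|d| > 4`, `(d/3) = (d/p) = 1`, `3 ∤ h_K`, `a² + 3d b² = 4`, `p ∤ Im((a + b√(−3d))^{(p+1)/3})`), then for some `p₂` and
every prime `p ≡ 8 (mod 9)`, `p ≥ p₂`: the conclusion of `HeegnerTwistCouplingInSupply` at `(W_p, p)` — an imaginary quadratic Heegner
field `K′` of `N(W_p)` with `|d_{K′}| > 4`, `L(W_p^{(d_{K′})}, 1) ≠ 0`, `p ∤ h(K′)`. [cite: CohenPazuki2009, §2]
[cite: BurungaleTian2026, Thm. 1.1] [cite: SilvermanATAEC1994, II Cor. 10.5.1] -/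
theorem cruxOnSylvesterCorner_of_relativeCertificateDensity
    (hDesc : ∀ (p : ℕ) (K : Type) [Field K] [NumberField K] (M a b : ℤ), p.Prime → p % 9 = 8 →
      IsImaginaryQuadratic K → 4 < (NumberField.discr K).natAbs →
      jacobiSym (NumberField.discr K) 3 = 1 → jacobiSym (NumberField.discr K) p = 1 →
      ¬ 3 ∣ NumberField.classNumber K → M = -3 * NumberField.discr K → a ^ 2 - M * b ^ 2 = 4 →
      ¬ (p : ℤ) ∣ ((⟨a, b⟩ : ℤ√M) ^ ((p + 1) / 3)).im →
      ((⟨0, 0, (p : ℚ), 0, 0⟩ : WeierstrassCurve ℚ).quadraticTwist (NumberField.discr K : ℚ)).mordellWeilRank = 0 ∧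
      ∀ c ∈ ((⟨0, 0, (p : ℚ), 0, 0⟩ : WeierstrassCurve ℚ).quadraticTwist (NumberField.discr K : ℚ)).sha,
        3 • c = 0 → c = 0)
    (hBT : burungaleTian_analyticRank_eq_zero_of_selmerCorank_eq_zero_of_hasCM)
    (hCD : ∃ (A : ℕ) (δ : ℝ) (p₁ : ℕ), 600 ^ 2 ≤ A ∧ 0 < δ ∧ ∀ p : ℕ, p.Prime → p % 9 = 8 → p₁ ≤ p →
      δ * ((ambient ((⟨0, 0, (p : ℚ), 0, 0⟩ : WeierstrassCurve ℚ).conductorNorm ℤ) (A * p ^ 2)).card : ℝ) ≤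
        (((Icc (-((A * p ^ 2 : ℕ) : ℤ)) (-1)).filter (fun d ↦
        ∃ (K : Type) (_ : Field K) (_ : NumberField K), IsImaginaryQuadratic K ∧ NumberField.discr K = d ∧
          4 < d.natAbs ∧ jacobiSym d 3 = 1 ∧ jacobiSym d p = 1 ∧ ¬ 3 ∣ NumberField.classNumber K ∧
          ∃ a b : ℤ, a ^ 2 - (-3 * d) * b ^ 2 = 4 ∧
            ¬ (p : ℤ) ∣ ((⟨a, b⟩ : ℤ√(-3 * d)) ^ ((p + 1) / 3)).im)).card : ℝ)) :
    ∃ p₂ : ℕ, ∀ p : ℕ, p.Prime → p % 9 = 8 → p₂ ≤ p →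
      ∃ (K : Type) (_ : Field K) (_ : NumberField K),
        IsImaginaryQuadratic K ∧ 4 < (NumberField.discr K).natAbs ∧
          SatisfiesHeegnerHypothesis ((⟨0, 0, (p : ℚ), 0, 0⟩ : WeierstrassCurve ℚ).conductorNorm ℤ) K ∧
          ((⟨0, 0, (p : ℚ), 0, 0⟩ : WeierstrassCurve ℚ).quadraticTwist (NumberField.discr K : ℚ)).entireLFunction 1 ≠ 0 ∧
          ¬ p ∣ NumberField.classNumber K := by
  obtain ⟨A, δ, p₁, hA, hδ, hCD⟩ := hCD
  refine cruxOnSylvesterCorner_of_certificateDensity hDesc hBT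
    DeuringHecke.hasEntireLFunction_of_j_mem_maximalCMJInvariants_holds ⟨A, δ / 360, p₁, ?_, by positivity, ?_⟩
  · exact le_trans (by norm_num) hA
  · intro p hp hp9 hle
    haveI := isElliptic_sylvester hp.ne_zero
    have hfam := card_ambient_sylvester_ge (A := A) hp hp9 hA
    have h := hCD p hp hp9 hle
    calc δ / 360 * ((A * p ^ 2 : ℕ) : ℝ) = δ * (((A * p ^ 2 : ℕ) : ℝ) / 360) := by ring
      _ ≤ δ * ((ambient ((⟨0, 0, (p : ℚ), 0, 0⟩ : WeierstrassCurve ℚ).conductorNorm ℤ) (A * p ^ 2)).card : ℝ) := by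
          gcongr
      _ ≤ _ := h

end Summit.BirchSwinnertonDyer.BirchSwinnertonDyer.Theorems.HeavyDiscriminant

end
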